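import Literature.Probability.LatticeModels.CumulantExponentialFormula
import Mathlib.RingTheory.PowerSeries.Exp
import Mathlib.RingTheory.PowerSeries.Derivative
import Mathlib.RingTheory.PowerSeries.Substitution
import HarnessLib

/-!
# The exponential formula for cumulants in closed form: `M = exp K`

Topic `Literature/Probability/LatticeModels`; continues `CumulantExponentialFormula.lean`, which
proves the differential form `M' = K' M` of the relation between the exponential generating
functions `M = Σₙ μₙ tⁿ/n!` of a moment sequence (`μ 0 = 1`) and `K = Σ_{n ≥ 1} κₙ tⁿ/n!` of its
cumulants `κ = cumulantOf μ`.  Here the closed form is derived in the ring of formal power series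
over a commutative `ℚ`-algebra:

`egf μ = exp ∘ K`, i.e. `Σₙ μₙ tⁿ/n! = exp (Σ_{n ≥ 1} κₙ tⁿ/n!)`   (`egf_eq_exp_subst_egfPos_cumulantOf`),

with Mathlib's `PowerSeries.exp` and substitution `PowerSeries.subst` — the formal-power-series
content of `∫P(dψ) e^{tX} = exp Σₙ tⁿ 𝓔ᵀ(X; n)/n!` (Mastropietro 2008, (2.36), and the recursive
definition of the effective potentials (2.50)–(2.53); Benfatto–Giuliani–Mastropietro 2006, (2.13),
(2.31): `𝒱^{(h-1)} + const = Σₙ (1/n!) 𝓔ᵀ_h(𝒱^{(h)}; n)`; Ruelle 1969, (4.5)–(4.7)).  The proof: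
both sides solve `F' = K' F` with `F(0) = 1` (`derivative_egf`, the landed `M' = K' M`, the chain
rule `derivative_subst` and `derivative_exp`), and such a linear equation has a unique solution
with given constant term over a `ℚ`-algebra (`eq_of_derivative_eq_mul`).  Everything is proved;
no named fact.

## Sources

D. Ruelle, *Statistical Mechanics: Rigorous Results* (1969), §4.4.1 (4.5)–(4.7) (`Ruelle1969`);
V. Mastropietro, *Non-Perturbative Renormalization* (2008), §2.3 (2.35)–(2.36), §2.5 (2.50)–(2.53)
(`Mastropietro2008`); G. Benfatto, A. Giuliani, V. Mastropietro, Ann. Henri Poincaré 7 (2006),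
(2.13), (2.31) (`BenfattoGiulianiMastropietro2006`).
-/

noncomputable section

open Finset PowerSeries

namespace Literature.Probability.LatticeModels

variable {C : Type*} [CommRing C] [Algebra ℚ C]

/-- The exponential generating function **without constant term**, `Σ_{n ≥ 1} aₙ tⁿ/n!` (the
generating function of the cumulants, `K(0) = 0`). [folklore] -/
def egfPos (a : ℕ → C) : PowerSeries C :=
  egf fun n => if n = 0 then 0 else a n

/-- `K(0) = 0`. [folklore] -/
theorem constantCoeff_egfPos (a : ℕ → C) : constantCoeff (egfPos a) = 0 := by
  rw [← coeff_zero_eq_constantCoeff_apply, egfPos, coeff_egf, if_pos rfl, mul_zero]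

/-- `M(0) = μ₀`. [folklore] -/
theorem constantCoeff_egf (a : ℕ → C) : constantCoeff (egf a) = a 0 := by
  rw [← coeff_zero_eq_constantCoeff_apply, coeff_egf, Nat.factorial_zero, Nat.cast_one, inv_one, map_one,
    one_mul]

/-- **The derivative of an exponential generating function is the generating function of the
shifted sequence.** [folklore] -/
theorem derivative_egf (a : ℕ → C) : d⁄dX C (egf a) = egf fun n => a (n + 1) := by
  ext n
  rw [coeff_derivative, coeff_egf, coeff_egf]
  have h : algebraMap ℚ C ((n + 1).factorial : ℚ)⁻¹ * (n + 1 : C) = algebraMap ℚ C (n.factorial : ℚ)⁻¹ := by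
    rw [show (n + 1 : C) = algebraMap ℚ C (n + 1 : ℚ) by rw [map_add, map_natCast, map_one], ← map_mul]
    congr 1
    have hn : (n.factorial : ℚ) ≠ 0 := by positivity
    have hn1 : (n + 1 : ℚ) ≠ 0 := by positivity
    rw [Nat.factorial_succ, Nat.cast_mul, Nat.cast_succ]
    field_simp
  calc algebraMap ℚ C ((n + 1).factorial : ℚ)⁻¹ * a (n + 1) * (n + 1 : C)
      = algebraMap ℚ C ((n + 1).factorial : ℚ)⁻¹ * (n + 1 : C) * a (n + 1) := by ring
    _ = algebraMap ℚ C (n.factorial : ℚ)⁻¹ * a (n + 1) := by rw [h]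

/-- `K' = Σₙ κ_{n+1} tⁿ/n!`. [folklore] -/
theorem derivative_egfPos (a : ℕ → C) : d⁄dX C (egfPos a) = egf fun n => a (n + 1) := by
  rw [egfPos, derivative_egf]
  simp only [Nat.succ_ne_zero, if_false]

/-- **Uniqueness for the linear equation `F' = g F`** over a `ℚ`-algebra: two solutions with the
same constant term coincide. [folklore] -/
theorem eq_of_derivative_eq_mul {F G g : PowerSeries C} (hF : d⁄dX C F = g * F) (hG : d⁄dX C G = g * G)
    (h0 : constantCoeff F = constantCoeff G) : F = G := by
  ext n
  induction n using Nat.strong_induction_on with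
  | _ n ih =>
    cases n with
    | zero => rwa [coeff_zero_eq_constantCoeff_apply, coeff_zero_eq_constantCoeff_apply]
    | succ n =>
      have hF' := congrArg (coeff n) hF
      have hG' := congrArg (coeff n) hG
      rw [coeff_derivative, coeff_mul] at hF' hG'
      have hsum : ∑ p ∈ antidiagonal n, coeff p.1 g * coeff p.2 F =
          ∑ p ∈ antidiagonal n, coeff p.1 g * coeff p.2 G :=
        sum_congr rfl fun p hp => by rw [ih p.2 (Nat.lt_succ_of_le (by have := mem_antidiagonal.1 hp; omega))]
      have h : coeff (n + 1) F * (n + 1 : C) = coeff (n + 1) G * (n + 1 : C) := by rw [hF', hG', hsum]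
      have hinv : (n + 1 : C) * algebraMap ℚ C ((n + 1 : ℚ)⁻¹) = 1 := by
        rw [show (n + 1 : C) = algebraMap ℚ C (n + 1 : ℚ) by rw [map_add, map_natCast, map_one], ← map_mul,
          mul_inv_cancel₀ (by positivity), map_one]
      calc coeff (n + 1) F = coeff (n + 1) F * ((n + 1 : C) * algebraMap ℚ C ((n + 1 : ℚ)⁻¹)) := by
            rw [hinv, mul_one]
        _ = coeff (n + 1) G * ((n + 1 : C) * algebraMap ℚ C ((n + 1 : ℚ)⁻¹)) := by
            rw [← mul_assoc, h, mul_assoc]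
        _ = coeff (n + 1) G := by rw [hinv, mul_one]

/-- `(exp ∘ K)' = K' · (exp ∘ K)` for `K(0) = 0` (chain rule). [folklore] -/
theorem derivative_exp_subst {K : PowerSeries C} (hK : constantCoeff K = 0) :
    d⁄dX C ((exp C).subst K) = d⁄dX C K * (exp C).subst K := by
  rw [derivative_subst C (HasSubst.of_constantCoeff_zero' hK), derivative_exp, mul_comm]

/-- `(exp ∘ K)(0) = 1` for `K(0) = 0`. [folklore] -/
theorem constantCoeff_exp_subst {K : PowerSeries C} (hK : constantCoeff K = 0) :
    constantCoeff ((exp C).subst K) = 1 := by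
  have h := constantCoeff_subst (HasSubst.of_constantCoeff_zero' hK) (exp C)
  have hK' : MvPowerSeries.constantCoeff K = 0 := hK
  have h1 : (finsum fun d : ℕ => coeff d (exp C) • MvPowerSeries.constantCoeff (K ^ d)) = 1 := by
    rw [finsum_eq_single _ 0 fun d hd => by rw [map_pow, hK', zero_pow hd, smul_zero], pow_zero, map_one,
      coeff_zero_eq_constantCoeff_apply, constantCoeff_exp, one_smul]
  rw [h1] at h
  exact h

/-- **The exponential formula in closed form, `M = exp K`**: for a moment sequence with `μ 0 = 1`
and cumulants `κ = cumulantOf μ`, `Σₙ μₙ tⁿ/n! = exp (Σ_{n ≥ 1} κₙ tⁿ/n!)` as formal power series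
over a commutative `ℚ`-algebra — the identity `∫P(dψ) e^{tX} = exp Σₙ tⁿ 𝓔ᵀ(X; n)/n!` behind the
recursive definition of the effective potentials (Mastropietro 2008, (2.36), (2.50)–(2.53);
Benfatto–Giuliani–Mastropietro 2006, (2.13), (2.31)). [cite: Ruelle1969, §4.4.1 (4.5)-(4.7)] -/
theorem egf_eq_exp_subst_egfPos_cumulantOf (μ : ℕ → C) (hμ : μ 0 = 1) :
    egf μ = (exp C).subst (egfPos (cumulantOf μ)) := by
  have hK := constantCoeff_egfPos (cumulantOf μ)
  refine eq_of_derivative_eq_mul (g := d⁄dX C (egfPos (cumulantOf μ))) ?_ (derivative_exp_subst hK) ?_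
  · rw [derivative_egf, derivative_egfPos, egf_shift_eq_egf_cumulantOf_shift_mul μ hμ]
  · rw [constantCoeff_egf, hμ, constantCoeff_exp_subst hK]

end Literature.Probability.LatticeModels
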